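/-
Copyright (c) 2026 the pub-hodgecm-mathlib formalisation cell (harness21).  Prover seat hodgecm-mathlib-K2E3-p21 (g5), Track B «K2-LIT» ∕ h413
(`stmt-HodgeConjecture-24833`), line `K2_E3_EllipticInputs`, unit U12 §L, road «GL-[M6]-sc» (line lead K2E3-p23 (g5); T20-GL₃ co-owned with K2E5-p17 (g4):
«(C-shell B) slice packaging», contract 2026-09-04T07:41:37Z ∕ 07:43:53Z «=»), brick T20-GL₃ (C-shell B), FILE 1: «THE SUPERCUSPIDAL ORBITAL SLICE
`f(z) = θ(mk(z γ z⁻¹))` ON `GL₃(F)` IS A CUSP FORM ALONG ALL EIGHTEEN DIRECTIONS» (the binders `hf`, `hcuspB`, `hcusp21`, `hcusp12` of ★ (C) `cuspForm_cancellation_GL3_split`).  2026-09-04.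
-/
import Summits.HodgeConjecture.HodgeConjecture.Theorems.K2E3GL3CuspFormCancellation                -- ★ (C) p858366 (K2E5-p17 g4): the head + `coe_permGL_inv_mul_mul_permGL`
import Summits.HodgeConjecture.HodgeConjecture.Theorems.K2E3GL3CuspFormCancellationBorel           -- ★ B4-A1 (K2E5-p17 g4): `integral_upperUnitriangular_conj_glDiagonal_eq_zero_of_cuspForm`; brings ★ B4-E1
import Summits.HodgeConjecture.HodgeConjecture.Theorems.K2E3GL3SupercuspidalCuspFormConjRadicals   -- ★ (B-Iw) F3 p858288 (this seat): transports; brings ★ B4-J FILES 1–4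
import HarnessLib

/-!
# K2_E3 road (h413), T20-GL₃ (C-shell B, file 1): the supercuspidal orbital slice `f(z) = B u' (ρ(π_Λ(z γ z⁻¹)) u)` upstairs on `GL₃(F)` — continuity and the
# HONEST transported cusp conditions along `w N_B w⁻¹`, `w N_{(2,1)} w⁻¹`, `w N_{(1,2)} w⁻¹` (`w = permGL σ`, all six chambers)

Cell `pub/hodgecm-mathlib` (D-0151), Track B, seat K2E3-p21 (g5).  CONSUMER: ★ (C) `K2E3GL3CuspFormCancellation.cuspForm_cancellation_GL3_split` (K2E5-p17 (g4)), whose binders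
`hf`, `hcuspB`, `hcusp21`, `hcusp12` this file DISCHARGES for the slice of a supercuspidal coefficient of `G' = GL₃(F) ⧸ Λ·1` (any `Λ₀`, `[CharZero F]`) through a REGULAR DIAGONAL
`γ` (`(γ : Matrix) = diagonal d`, `d` injective); `hsupp` (★ T18) and the final `hcanc` (★ (C) ∘ ★ (C-shell A)) are FILE 2.  `--supports stmt-HodgeConjecture-24833 --as helper`;
THEOREMS ONLY (no definition ∕ instance ∕ notation ∕ named-fact hypothesis ∕ `sorry`).

THE MATHEMATICS [HarishChandra1970, Part I §3 p. 9; Part VII §2 Thm 20, §8 pp. 80–84]; [Casselman1995, Thm. 5.3.1]; [Rogawski1990, §4.13 p. 70].  For `w = permGL σ` and `u` in a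
base radical `U`: `f(x·(w u w⁻¹)) = θ̃((x w)·(u γ^w u⁻¹)·(x w)⁻¹)` with `γ^w = w⁻¹ γ w = glDiagonal (d ∘ σ⁻¹)` again regular diagonal (★ (C) `coe_permGL_inv_mul_mul_permGL`), so
each binder is a cusp-form CANCELLATION for the coefficient `θ̃ = B u' (ρ(π_Λ ·) u)` at the point `x w`: ★ B4-A1 along `N_B` (from the two-sided cusp property of `θ̃` along
`N_{(2,1)}`, ★ B4-J FILE 4), ★ B4-E1 along `N_{(2,1)}`, and ★ B4-E1 along `N̄_{(2,1)}` transported by `w₀` to `N_{(1,2)} = w₀ N̄_{(2,1)} w₀⁻¹`; the `Fin 2`-labelled carriers of (C) are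
reached from the `Bool`-labelled carriers of B4-A1∕B4-E1 by the equality transport (★ (B-Iw) F1 `unipotentRadicalGL_eq_of_forall_le_iff`).
* §1 generic: `integral_comp_coe_eq_zero_of_continuousMulEquiv` ∕ `_of_eq` ∕ `_map_conj_weylLong` (transport of `∫_H φ(↑v) dν = 0` for ARBITRARY integrands `φ`, every Haar `ν`).
* §2 `glDiagonal_mk0_eq`, `permGL_inv_mul_mul_permGL_eq_glDiagonal` (`w⁻¹ γ w` as a `glDiagonal` of units), `continuous_slice` (`hf`).
* §3 **`slice_hcuspB`**, **`slice_hcusp21`**, **`slice_hcusp12`** — ★ (C)'s three cusp binders VERBATIM for `f = fun z => B u' (ρ (QuotientGroup.mk (z * γ * z⁻¹)) u)`.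

HONEST LABEL: HC_CM is proved only modulo the 7 printed citations (2 remaining named inputs: hLiu418 = `stmt-HodgeConjecture-24832`, h413 = `stmt-HodgeConjecture-24833`)
until rung 0 closes; this file is a count-neutral helper and closes no socket.

## References
* [HarishChandra1970] Harish-Chandra (notes by G. van Dijk), *Harmonic Analysis on Reductive p-adic Groups*, LNM 162 (1970), Part I §3 p. 9; Part VII §2, §8.
* [Casselman1995] W. Casselman, *Introduction to the theory of admissible representations of `p`-adic reductive groups* (1995 notes), Thm. 5.3.1, Prop. 1.4.4.
* [Rogawski1990] J. D. Rogawski, *Automorphic Representations of Unitary Groups in Three Variables*, Ann. of Math. Stud. 123 (1990), §4.13 p. 70.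
-/

set_option autoImplicit false
-- the mandated namespace repeats the single-problem summit's segment (`HodgeConjecture.HodgeConjecture`)
set_option linter.dupNamespace false

noncomputable section

open MeasureTheory MeasureTheory.Measure Set Filter Topology
open scoped MatrixGroups Pointwise WithZero
open Literature.NumberTheory.Automorphic Literature.NumberTheory.GaloisRepresentations Literature.NumberTheory.GaloisRepresentations.IsNonarchimedeanLocalField
open Summit.HodgeConjecture.HodgeConjecture.Cruxes.H413.K2E3GLnUnipotentExhaustion
open Summit.HodgeConjecture.HodgeConjecture.Cruxes.H413.K2E3GL3SupercuspidalCuspFormOppositeRadicals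
open Summit.HodgeConjecture.HodgeConjecture.Cruxes.H413.K2E3GL3SupercuspidalCuspFormConjRadicals
open Summit.HodgeConjecture.HodgeConjecture.Cruxes.H413.K2E3GLnCongruenceIwahoriTriple (unipotentRadicalGL_eq_of_forall_le_iff)
open Summit.HodgeConjecture.HodgeConjecture.Cruxes.H413.K2E3GL3CuspFormCancellation (coe_permGL_inv_mul_mul_permGL)
open Summit.HodgeConjecture.HodgeConjecture.Cruxes.H413.K2E3GL3CuspFormCancellationBorel
open Summit.HodgeConjecture.HodgeConjecture.Cruxes.H413.K2E3GL3CuspFormCancellationMaxParabolic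

namespace Summit.HodgeConjecture.HodgeConjecture.Cruxes.H413.K2E3GL3SupercuspOrbitalSliceCuspidal

/-! ## §1  Generic: transport of `∫_H φ(↑v) dν = 0` (every Haar `ν`) along conjugation ∕ equality of subgroups -/

section Generic

variable {G : Type*} [Group G] [TopologicalSpace G] [IsTopologicalGroup G] {E : Type*} [NormedAddCommGroup E] [NormedSpace ℝ E]

/-- **Transport of a vanishing integral for an arbitrary integrand** along `e : H₁ ≃ₜ* H₂` with `↑(e u) = w u w⁻¹`: if `∫_{H₁} φ(w u w⁻¹) dν₁(u) = 0` for every Haar `ν₁`, then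
`∫_{H₂} φ(v) dν₂(v) = 0` for every Haar `ν₂` (`ν₂ = e_*(e⁻¹_* ν₂)`). [cite: HarishChandra1970, Part I §3 p. 9] -/
theorem integral_comp_coe_eq_zero_of_continuousMulEquiv (H₁ H₂ : Subgroup G) [MeasurableSpace ↥H₁] [BorelSpace ↥H₁] [MeasurableSpace ↥H₂] [BorelSpace ↥H₂]
    (w : G) (e : ↥H₁ ≃ₜ* ↥H₂) (he : ∀ u : ↥H₁, ((e u : ↥H₂) : G) = w * (u : G) * w⁻¹) (φ : G → E)
    (h₁ : ∀ (ν₁ : Measure ↥H₁), ν₁.IsHaarMeasure → ∫ u, φ (w * (u : G) * w⁻¹) ∂ν₁ = 0)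
    (ν₂ : Measure ↥H₂) [ν₂.IsHaarMeasure] : ∫ v, φ (v : G) ∂ν₂ = 0 := by
  haveI : (ν₂.map e.symm).IsHaarMeasure := e.symm.isHaarMeasure_map ν₂
  have hme : Measurable (e : ↥H₁ → ↥H₂) := e.continuous.measurable
  have hms : Measurable (e.symm : ↥H₂ → ↥H₁) := e.symm.continuous.measurable
  have hmap : (ν₂.map e.symm).map e = ν₂ := by
    rw [Measure.map_map hme hms]
    have hid : ((e : ↥H₁ → ↥H₂) ∘ (e.symm : ↥H₂ → ↥H₁)) = id := funext fun v => e.apply_symm_apply v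
    rw [hid, Measure.map_id]
  calc ∫ v, φ (v : G) ∂ν₂ = ∫ v, φ (v : G) ∂((ν₂.map e.symm).map e) := by rw [hmap]
    _ = ∫ u, φ ((e u : ↥H₂) : G) ∂(ν₂.map e.symm) := e.toHomeomorph.measurableEmbedding.integral_map _
    _ = ∫ u, φ (w * (u : G) * w⁻¹) ∂(ν₂.map e.symm) := by simp only [he]
    _ = 0 := h₁ _ inferInstance

/-- **Transport over EQUAL subgroups written differently** (e.g. `Bool`- vs `Fin 2`-labelled radicals). [cite: HarishChandra1970, Part I §3 p. 9] -/
theorem integral_comp_coe_eq_zero_of_eq {H₁ H₂ : Subgroup G} (h : H₁ = H₂) [MeasurableSpace ↥H₁] [BorelSpace ↥H₁] [MeasurableSpace ↥H₂] [BorelSpace ↥H₂]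
    (φ : G → E) (h₁ : ∀ (ν₁ : Measure ↥H₁), ν₁.IsHaarMeasure → ∫ u, φ (u : G) ∂ν₁ = 0)
    (ν₂ : Measure ↥H₂) [ν₂.IsHaarMeasure] : ∫ v, φ (v : G) ∂ν₂ = 0 := by
  obtain ⟨e, he⟩ := exists_continuousMulEquiv_of_eq (G := G) h
  exact integral_comp_coe_eq_zero_of_continuousMulEquiv H₁ H₂ 1 e (fun u => by rw [he, one_mul, inv_one, mul_one]) φ
    (fun ν₁ hν₁ => by simpa only [one_mul, inv_one, mul_one] using h₁ ν₁ hν₁) ν₂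

end Generic

/-! ## §2  The slice: the conjugated torus element and continuity -/

section Slice

variable {F : Type*} [Field F] [ValuativeRel F] [TopologicalSpace F] [IsNonarchimedeanLocalField F] [CharZero F]
  [MeasurableSpace F] [BorelSpace F] [MeasurableSpace (GL (Fin 3) F)] [BorelSpace (GL (Fin 3) F)]
  (Λ₀ : Subgroup Fˣ) [(Λ₀.map (Matrix.GeneralLinearGroup.scalar (Fin 3))).Normal]
  {V : Type*} [AddCommGroup V] [Module ℂ V] (ρ : Representation ℂ (GL (Fin 3) F ⧸ Λ₀.map (Matrix.GeneralLinearGroup.scalar (Fin 3))) V)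
  {B : V →ₗ⋆[ℂ] V →ₗ[ℂ] ℂ}

omit [ValuativeRel F] [TopologicalSpace F] [IsNonarchimedeanLocalField F] [CharZero F] [MeasurableSpace F] [BorelSpace F]
  [MeasurableSpace (GL (Fin 3) F)] [BorelSpace (GL (Fin 3) F)] in
/-- **`w⁻¹ γ w` is the `glDiagonal` of the permuted units** (`w = permGL σ`, `(γ : Matrix) = diagonal d`, `d i ≠ 0`; ★ (C) `coe_permGL_inv_mul_mul_permGL`). [cite: HarishChandra1970, Part VII §8 p. 80] -/
theorem permGL_inv_mul_mul_permGL_eq_glDiagonal (σ : Equiv.Perm (Fin 3)) {γ : GL (Fin 3) F} {d : Fin 3 → F} (hγ : (γ : Matrix (Fin 3) (Fin 3) F) = Matrix.diagonal d)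
    (hd0 : ∀ i, d i ≠ 0) :
    (permGL σ)⁻¹ * γ * permGL σ = glDiagonal 3 F (fun i => Units.mk0 (d (σ⁻¹ i)) (hd0 _)) := by
  refine Units.ext ?_
  rw [coe_permGL_inv_mul_mul_permGL σ hγ, coe_glDiagonal]
  rfl

omit [CharZero F] [MeasurableSpace F] [BorelSpace F] [MeasurableSpace (GL (Fin 3) F)] [BorelSpace (GL (Fin 3) F)] in
/-- **(hf) The slice `z ↦ B u' (ρ(π_Λ(z γ z⁻¹)) u)` is continuous** for `ρ` smooth (locally constant coefficient ★ `IsSmooth.isLocallyConstant_apply`).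
[cite: HarishChandra1970, Part I §3 p. 9] -/
theorem continuous_slice (hρ : ρ.IsSmooth) (γ : GL (Fin 3) F) (u u' : V) :
    Continuous fun z : GL (Fin 3) F => B u' (ρ (QuotientGroup.mk (z * γ * z⁻¹) : GL (Fin 3) F ⧸ Λ₀.map (Matrix.GeneralLinearGroup.scalar (Fin 3))) u) :=
  ((Representation.IsSmooth.isLocallyConstant_apply ρ hρ u).comp fun w : V => B u' w).continuous.comp
    (QuotientGroup.continuous_mk.comp ((continuous_id.mul continuous_const).mul continuous_id.inv))

omit [ValuativeRel F] [TopologicalSpace F] [IsNonarchimedeanLocalField F] [CharZero F] [MeasurableSpace F] [BorelSpace F]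
  [MeasurableSpace (GL (Fin 3) F)] [BorelSpace (GL (Fin 3) F)] in
/-- The slice at `x·(w u w⁻¹)` is the conjugation coefficient at `(x w)·(u γ^w u⁻¹)·(x w)⁻¹`, `γ^w = w⁻¹ γ w`. [folklore] -/
theorem slice_mul_conj_eq (γ x w u : GL (Fin 3) F) (v v' : V) :
    B v' (ρ (QuotientGroup.mk ((x * (w * u * w⁻¹)) * γ * (x * (w * u * w⁻¹))⁻¹) : GL (Fin 3) F ⧸ Λ₀.map (Matrix.GeneralLinearGroup.scalar (Fin 3))) v) =
      B v' (ρ (QuotientGroup.mk ((x * w) * (u * (w⁻¹ * γ * w) * u⁻¹) * (x * w)⁻¹) : GL (Fin 3) F ⧸ Λ₀.map (Matrix.GeneralLinearGroup.scalar (Fin 3))) v) := by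
  congr 4
  group

/-! ## §3  The three cusp binders of ★ (C) for the slice -/

variable (hρ : ρ.IsSmooth) (hsc : ρ.IsSupercuspidal) (hBinv : ∀ (g : GL (Fin 3) F ⧸ Λ₀.map (Matrix.GeneralLinearGroup.scalar (Fin 3))) (v w : V), B (ρ g v) (ρ g w) = B v w)
  {γ : GL (Fin 3) F} {d : Fin 3 → F} (hγ : (γ : Matrix (Fin 3) (Fin 3) F) = Matrix.diagonal d) (hd : Function.Injective d) (u u' : V)

include hρ hsc hBinv hγ hd in
/-- **(hcuspB) The slice is a cusp form along `w N_B w⁻¹`, all chambers** — ★ (C)'s binder `hcuspB` VERBATIM: for every `σ`, every Haar `ν₀` of `↥(unipotentRadicalGL F id)` and every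
`x`, `∫ f(x · (permGL σ · u · (permGL σ)⁻¹)) dν₀(u) = 0`.  ★ B4-A1 at the point `x·w` for the regular diagonal `w⁻¹γw`, fed by the two-sided cusp property of `θ̃` along `N_{(2,1)}`
(★ B4-J FILE 4, Bool labels `![false,false,true]`). [cite: HarishChandra1970, Part VII §2 Thm 20, §8 Lemma 57] [cite: Casselman1995, Thm. 5.3.1] -/
theorem slice_hcuspB (σ : Equiv.Perm (Fin 3)) (ν₀ : Measure ↥(unipotentRadicalGL F (id : Fin 3 → Fin 3))) [ν₀.IsHaarMeasure] (x : GL (Fin 3) F) :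
    ∫ n, (fun z : GL (Fin 3) F => B u' (ρ (QuotientGroup.mk (z * γ * z⁻¹) : GL (Fin 3) F ⧸ Λ₀.map (Matrix.GeneralLinearGroup.scalar (Fin 3))) u))
      (x * (permGL σ * (n : GL (Fin 3) F) * (permGL σ)⁻¹)) ∂ν₀ = 0 := by
  haveI : T2Space F := (isLocalField F).toT2Space
  have hd0 : ∀ i, d i ≠ 0 := fun i h0 => by
    have hdet : (γ : Matrix (Fin 3) (Fin 3) F).det ≠ 0 := ((Matrix.isUnit_iff_isUnit_det _).1 (Units.isUnit γ)).ne_zero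
    rw [hγ, Matrix.det_diagonal] at hdet
    exact hdet (Finset.prod_eq_zero (Finset.mem_univ i) h0)
  -- a Haar measure on the (2,1)-radical (Bool labels) and the two-sided cusp property of `θ̃` there
  haveI := locallyCompactSpace_unipotentRadicalGL (F := F) (![false, false, true] : Fin 3 → Bool)
  haveI := secondCountableTopology_unipotentRadicalGL (F := F) (![false, false, true] : Fin 3 → Bool)
  set νU : Measure ↥(unipotentRadicalGL F (![false, false, true] : Fin 3 → Bool)) := Measure.haar with hνU
  have hcusp : ∀ a b : GL (Fin 3) F, ∫ uu : ↥(unipotentRadicalGL F (![false, false, true] : Fin 3 → Bool)),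
      B u' (ρ (QuotientGroup.mk (a * (uu : GL (Fin 3) F) * b) : GL (Fin 3) F ⧸ Λ₀.map (Matrix.GeneralLinearGroup.scalar (Fin 3))) u) ∂νU = 0 :=
    fun a b => integral_sesqForm_apply_translate_unipotentRadicalGL_comp_mk_eq_zero' Λ₀ ρ hρ hsc
      (c := (![false, false, true] : Fin 3 → Bool)) ⟨fun t => by rcases Bool.eq_false_or_eq_true t with rfl | rfl <;> [exact ⟨2, rfl⟩; exact ⟨0, rfl⟩], inferInstance⟩
      (by decide) νU hBinv a b u u'
  -- B4-A1 at the point `x·w` for `γ^w = glDiagonal (d ∘ σ⁻¹)`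
  have h02 : ((Units.mk0 (d (σ⁻¹ 0)) (hd0 _) : Fˣ) : F) ≠ (Units.mk0 (d (σ⁻¹ 2)) (hd0 _) : Fˣ) := fun h => by
    have := hd (by simpa using h); exact absurd (σ⁻¹.injective this) (by decide)
  have h12 : ((Units.mk0 (d (σ⁻¹ 1)) (hd0 _) : Fˣ) : F) ≠ (Units.mk0 (d (σ⁻¹ 2)) (hd0 _) : Fˣ) := fun h => by
    have := hd (by simpa using h); exact absurd (σ⁻¹.injective this) (by decide)
  have hA := integral_upperUnitriangular_conj_glDiagonal_eq_zero_of_cuspForm ν₀ νU (fun i => Units.mk0 (d (σ⁻¹ i)) (hd0 _)) h02 h12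
    (fun g : GL (Fin 3) F => B u' (ρ (QuotientGroup.mk g : GL (Fin 3) F ⧸ Λ₀.map (Matrix.GeneralLinearGroup.scalar (Fin 3))) u)) hcusp (x * permGL σ) (x * permGL σ)⁻¹
  rw [← permGL_inv_mul_mul_permGL_eq_glDiagonal σ hγ hd0] at hA
  simp only [slice_mul_conj_eq]
  exact hA

include hρ hsc hBinv hγ hd in
/-- **(hcusp21) The slice is a cusp form along `w N_{(2,1)} w⁻¹`, all chambers** — ★ (C)'s binder `hcusp21` VERBATIM (carrier `unipotentRadicalGL F (![0,0,1] : Fin 3 → Fin 2)`): ★ B4-E1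
`integral_unipotentRadical21_conj_eq_zero_of_cuspForm` on the `Bool` carrier at `x·w`, then the equality transport `Bool ↔ Fin 2` (§1).
[cite: HarishChandra1970, Part VII §2 Thm 20, §8 Lemma 57] [cite: Rogawski1990, §4.13 p. 70] -/
theorem slice_hcusp21 (σ : Equiv.Perm (Fin 3)) (ν₀ : Measure ↥(unipotentRadicalGL F (![0, 0, 1] : Fin 3 → Fin 2))) [ν₀.IsHaarMeasure] (x : GL (Fin 3) F) :
    ∫ n, (fun z : GL (Fin 3) F => B u' (ρ (QuotientGroup.mk (z * γ * z⁻¹) : GL (Fin 3) F ⧸ Λ₀.map (Matrix.GeneralLinearGroup.scalar (Fin 3))) u))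
      (x * (permGL σ * (n : GL (Fin 3) F) * (permGL σ)⁻¹)) ∂ν₀ = 0 := by
  haveI : T2Space F := (isLocalField F).toT2Space
  have hd0 : ∀ i, d i ≠ 0 := fun i h0 => by
    have hdet : (γ : Matrix (Fin 3) (Fin 3) F).det ≠ 0 := ((Matrix.isUnit_iff_isUnit_det _).1 (Units.isUnit γ)).ne_zero
    rw [hγ, Matrix.det_diagonal] at hdet
    exact hdet (Finset.prod_eq_zero (Finset.mem_univ i) h0)
  have h02 : ((Units.mk0 (d (σ⁻¹ 0)) (hd0 _) : Fˣ) : F) ≠ (Units.mk0 (d (σ⁻¹ 2)) (hd0 _) : Fˣ) := fun h => by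
    have := hd (by simpa using h); exact absurd (σ⁻¹.injective this) (by decide)
  have h12 : ((Units.mk0 (d (σ⁻¹ 1)) (hd0 _) : Fˣ) : F) ≠ (Units.mk0 (d (σ⁻¹ 2)) (hd0 _) : Fˣ) := fun h => by
    have := hd (by simpa using h); exact absurd (σ⁻¹.injective this) (by decide)
  -- the equality of the `Bool`- and `Fin 2`-labelled (2,1)-radicals
  have hEq : unipotentRadicalGL F (![false, false, true] : Fin 3 → Bool) = unipotentRadicalGL F (![0, 0, 1] : Fin 3 → Fin 2) :=
    unipotentRadicalGL_eq_of_forall_le_iff fun i j => by fin_cases i <;> fin_cases j <;> decide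
  borelize ↥(unipotentRadicalGL F (![false, false, true] : Fin 3 → Bool))
  refine integral_comp_coe_eq_zero_of_eq hEq
    (fun g : GL (Fin 3) F => B u' (ρ (QuotientGroup.mk ((x * (permGL σ * g * (permGL σ)⁻¹)) * γ * (x * (permGL σ * g * (permGL σ)⁻¹))⁻¹) :
      GL (Fin 3) F ⧸ Λ₀.map (Matrix.GeneralLinearGroup.scalar (Fin 3))) u)) (fun ν₁ hν₁ => ?_) ν₀
  haveI := hν₁
  have hcusp : ∀ a b : GL (Fin 3) F, ∫ uu : ↥(unipotentRadicalGL F (![false, false, true] : Fin 3 → Bool)),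
      B u' (ρ (QuotientGroup.mk (a * (uu : GL (Fin 3) F) * b) : GL (Fin 3) F ⧸ Λ₀.map (Matrix.GeneralLinearGroup.scalar (Fin 3))) u) ∂ν₁ = 0 :=
    fun a b => integral_sesqForm_apply_translate_unipotentRadicalGL_comp_mk_eq_zero' Λ₀ ρ hρ hsc
      (c := (![false, false, true] : Fin 3 → Bool)) ⟨fun t => by rcases Bool.eq_false_or_eq_true t with rfl | rfl <;> [exact ⟨2, rfl⟩; exact ⟨0, rfl⟩], inferInstance⟩
      (by decide) ν₁ hBinv a b u u'
  have hE := integral_unipotentRadical21_conj_eq_zero_of_cuspForm ν₁ (glDiagonal_mem_standardLeviGL21 (fun i => Units.mk0 (d (σ⁻¹ i)) (hd0 _)))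
    (by rw [eval_charpoly_glDiagonal_topLeft]; exact mul_ne_zero (sub_ne_zero.2 h02.symm) (sub_ne_zero.2 h12.symm))
    (fun g : GL (Fin 3) F => B u' (ρ (QuotientGroup.mk g : GL (Fin 3) F ⧸ Λ₀.map (Matrix.GeneralLinearGroup.scalar (Fin 3))) u)) hcusp (x * permGL σ) (x * permGL σ)⁻¹
  rw [← permGL_inv_mul_mul_permGL_eq_glDiagonal σ hγ hd0] at hE
  simp only [slice_mul_conj_eq]
  exact hE

include hρ hsc hBinv hγ hd in
/-- **(hcusp12) The slice is a cusp form along `w N_{(1,2)} w⁻¹`, all chambers** — ★ (C)'s binder `hcusp12` VERBATIM (carrier `unipotentRadicalGL F (![0,1,1] : Fin 3 → Fin 2)`).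
`N_{(1,2)} = w₀ N̄_{(2,1)} w₀⁻¹`: ★ B4-E1's OPPOSITE-(2,1) cancellation at the point `x·w·w₀` for the regular diagonal `(w w₀)⁻¹ γ (w w₀)` (fed by ★ B4-J FILE 4's cusp property along
`N̄_{(2,1)}`), transported by `w₀ = weylLong 3 F` (★ FILE 4 `exists_continuousMulEquiv_unipotentRadicalGL_conj_weylLong`) and then from `Bool` to `Fin 2` labels (§1).
[cite: HarishChandra1970, Part VII §2 Thm 20, §8 Lemma 57] [cite: Rogawski1990, §4.13 p. 70] -/
theorem slice_hcusp12 (σ : Equiv.Perm (Fin 3)) (ν₀ : Measure ↥(unipotentRadicalGL F (![0, 1, 1] : Fin 3 → Fin 2))) [ν₀.IsHaarMeasure] (x : GL (Fin 3) F) :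
    ∫ n, (fun z : GL (Fin 3) F => B u' (ρ (QuotientGroup.mk (z * γ * z⁻¹) : GL (Fin 3) F ⧸ Λ₀.map (Matrix.GeneralLinearGroup.scalar (Fin 3))) u))
      (x * (permGL σ * (n : GL (Fin 3) F) * (permGL σ)⁻¹)) ∂ν₀ = 0 := by
  haveI : T2Space F := (isLocalField F).toT2Space
  have hd0 : ∀ i, d i ≠ 0 := fun i h0 => by
    have hdet : (γ : Matrix (Fin 3) (Fin 3) F).det ≠ 0 := ((Matrix.isUnit_iff_isUnit_det _).1 (Units.isUnit γ)).ne_zero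
    rw [hγ, Matrix.det_diagonal] at hdet
    exact hdet (Finset.prod_eq_zero (Finset.mem_univ i) h0)
  -- the twice-conjugated torus element `t = (w w₀)⁻¹ γ (w w₀) = glDiagonal (d ∘ σ⁻¹ ∘ rev)`
  have hγw : (((permGL σ)⁻¹ * γ * permGL σ : GL (Fin 3) F) : Matrix (Fin 3) (Fin 3) F) = Matrix.diagonal (d ∘ ⇑σ⁻¹) :=
    coe_permGL_inv_mul_mul_permGL σ hγ
  have ht : (weylLong 3 F)⁻¹ * ((permGL σ)⁻¹ * γ * permGL σ) * weylLong 3 F =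
      glDiagonal 3 F (fun i => Units.mk0 (d (σ⁻¹ (Fin.revPerm⁻¹ i))) (hd0 _)) := by
    rw [weylLong_eq_permGL]
    exact permGL_inv_mul_mul_permGL_eq_glDiagonal Fin.revPerm hγw fun i => hd0 _
  have h02 : ((Units.mk0 (d (σ⁻¹ (Fin.revPerm⁻¹ 0))) (hd0 _) : Fˣ) : F) ≠ (Units.mk0 (d (σ⁻¹ (Fin.revPerm⁻¹ 2))) (hd0 _) : Fˣ) := fun h => by
    have := σ⁻¹.injective (hd (by simpa using h)); exact absurd this (by decide)
  have h12 : ((Units.mk0 (d (σ⁻¹ (Fin.revPerm⁻¹ 1))) (hd0 _) : Fˣ) : F) ≠ (Units.mk0 (d (σ⁻¹ (Fin.revPerm⁻¹ 2))) (hd0 _) : Fˣ) := fun h => by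
    have := σ⁻¹.injective (hd (by simpa using h)); exact absurd this (by decide)
  -- Bool ↔ Fin 2 labels for `N_{(1,2)}`
  have hEq : unipotentRadicalGL F (![false, true, true] : Fin 3 → Bool) = unipotentRadicalGL F (![0, 1, 1] : Fin 3 → Fin 2) :=
    unipotentRadicalGL_eq_of_forall_le_iff fun i j => by fin_cases i <;> fin_cases j <;> decide
  borelize ↥(unipotentRadicalGL F (![false, true, true] : Fin 3 → Bool))
  borelize ↥(unipotentRadicalGL F (![true, true, false] : Fin 3 → Bool))
  refine integral_comp_coe_eq_zero_of_eq hEq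
    (fun g : GL (Fin 3) F => B u' (ρ (QuotientGroup.mk ((x * (permGL σ * g * (permGL σ)⁻¹)) * γ * (x * (permGL σ * g * (permGL σ)⁻¹))⁻¹) :
      GL (Fin 3) F ⧸ Λ₀.map (Matrix.GeneralLinearGroup.scalar (Fin 3))) u)) (fun ν₂ hν₂ => ?_) ν₀
  haveI := hν₂
  -- `N_{(1,2)} = w₀ N̄_{(2,1)} w₀⁻¹`
  obtain ⟨e, he⟩ := exists_continuousMulEquiv_unipotentRadicalGL_conj_weylLong (F := F) (![true, true, false] : Fin 3 → Bool) (![false, true, true] : Fin 3 → Bool)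
    (fun i => by fin_cases i <;> rfl)
  refine integral_comp_coe_eq_zero_of_continuousMulEquiv _ _ (weylLong 3 F) e he
    (fun g : GL (Fin 3) F => B u' (ρ (QuotientGroup.mk ((x * (permGL σ * g * (permGL σ)⁻¹)) * γ * (x * (permGL σ * g * (permGL σ)⁻¹))⁻¹) :
      GL (Fin 3) F ⧸ Λ₀.map (Matrix.GeneralLinearGroup.scalar (Fin 3))) u)) (fun ν₁ hν₁ => ?_) ν₂
  haveI := hν₁
  -- the two-sided cusp property of `θ̃` along `N̄_{(2,1)}` and ★ B4-E1 (opposite) at `x w w₀`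
  have hcusp : ∀ a b : GL (Fin 3) F, ∫ vv : ↥(unipotentRadicalGL F (![true, true, false] : Fin 3 → Bool)),
      B u' (ρ (QuotientGroup.mk (a * (vv : GL (Fin 3) F) * b) : GL (Fin 3) F ⧸ Λ₀.map (Matrix.GeneralLinearGroup.scalar (Fin 3))) u) ∂ν₁ = 0 :=
    fun a b => integral_sesqForm_apply_translate_unipotentRadicalGL_opposite_comp_mk_eq_zero Λ₀ ρ hρ hsc (c₁ := (![false, true, true] : Fin 3 → Bool))
      (c₂ := (![true, true, false] : Fin 3 → Bool))
      ⟨fun t => by rcases Bool.eq_false_or_eq_true t with rfl | rfl <;> [exact ⟨1, rfl⟩; exact ⟨0, rfl⟩], inferInstance⟩ (by decide)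
      (fun i => by fin_cases i <;> rfl) ν₁ hBinv a b u u'
  have hE := integral_oppositeUnipotentRadical21_conj_eq_zero_of_cuspForm ν₁
    (glDiagonal_mem_standardLeviGL21 (fun i => Units.mk0 (d (σ⁻¹ (Fin.revPerm⁻¹ i))) (hd0 _)))
    (by rw [eval_charpoly_glDiagonal_topLeft]; exact mul_ne_zero (sub_ne_zero.2 h02.symm) (sub_ne_zero.2 h12.symm))
    (fun g : GL (Fin 3) F => B u' (ρ (QuotientGroup.mk g : GL (Fin 3) F ⧸ Λ₀.map (Matrix.GeneralLinearGroup.scalar (Fin 3))) u)) hcusp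
    (x * permGL σ * weylLong 3 F) (x * permGL σ * weylLong 3 F)⁻¹
  rw [← ht] at hE
  have heq : (fun vv : ↥(unipotentRadicalGL F (![true, true, false] : Fin 3 → Bool)) =>
      B u' (ρ (QuotientGroup.mk ((x * (permGL σ * (weylLong 3 F * (vv : GL (Fin 3) F) * (weylLong 3 F)⁻¹) * (permGL σ)⁻¹)) * γ *
        (x * (permGL σ * (weylLong 3 F * (vv : GL (Fin 3) F) * (weylLong 3 F)⁻¹) * (permGL σ)⁻¹))⁻¹) : GL (Fin 3) F ⧸ Λ₀.map (Matrix.GeneralLinearGroup.scalar (Fin 3))) u)) =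
      fun vv : ↥(unipotentRadicalGL F (![true, true, false] : Fin 3 → Bool)) => B u' (ρ (QuotientGroup.mk (x * permGL σ * weylLong 3 F *
        ((vv : GL (Fin 3) F) * ((weylLong 3 F)⁻¹ * ((permGL σ)⁻¹ * γ * permGL σ) * weylLong 3 F) * (vv : GL (Fin 3) F)⁻¹) *
          (x * permGL σ * weylLong 3 F)⁻¹) : GL (Fin 3) F ⧸ Λ₀.map (Matrix.GeneralLinearGroup.scalar (Fin 3))) u) := by
    funext vv
    congr 4
    group
  rw [heq]
  exact hE

end Slice

end Summit.HodgeConjecture.HodgeConjecture.Cruxes.H413.K2E3GL3SupercuspOrbitalSliceCuspidal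

end
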